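import Literature.NumberTheory.EllipticCurves.PAdicOneVariableDilation
import Literature.NumberTheory.EllipticCurves.PAdicOneVariableMomentDensity
import Literature.NumberTheory.EllipticCurves.PAdicDistributionPushforward
import Literature.NumberTheory.EllipticCurves.PAdicDistributionDensity
import Literature.NumberTheory.EllipticCurves.PAdicOneVariableCharacterSupport
import HarnessLib

/-!
# The affine push-forward `y ↦ a + u·y` of a measure on `ℤ_p` and its power series
# `(1+S)^a · H((1+S)^u − 1)`; the SERIES form of de Shalit's I.3.3 (7) ⟺ (7′):
# `D_{(1+S)^a · H((1+S)^p − 1)} = (a + p·)_* D_H` is supported on `a + pℤ_p`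

De Shalit 1987, I.3.1 (1) (p. 16): "`P_μ(S) = ∫ (1+S)^α dμ(α)`"; I.3.3 (p. 17): "(7′)
`P̃_μ(S) = P_μ(S) − (1/p) Σ_{ς^p=1} P_μ(ς(1+S) − 1)` […] `μ̃ = μ|ℤ_p^×`"; I.3.4 Lemma (ii) (p. 18) (dilations).

In the dictionary `μ ↦ P_μ` translation of `ℤ_p` by `a` is multiplication by `(1+S)^a` and the dilation
`y ↦ u y` is the substitution `S ↦ (1+S)^u − 1` (tree: `binomDilate`, `invAmice₁_binomDilate_μ` for units
`u`). This file treats the general AFFINE map `y ↦ a + u y` (`a, u ∈ ℤ_p`, `u` NOT necessarily a unit),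
whose case `u = p` is the series side of (7) ⟺ (7′): the kernel of the `Ĝ_m`-trace
`𝒮H = Σ_{ς^p=1} H(ς(1+S) − 1)` on `𝒪⟦S⟧` is `⊕_{0<a<p} (1+S)^a · 𝒪⟦(1+S)^p − 1⟧` (at `p = 2`:
`(1+S)·𝒪⟦(1+S)² − 1⟧`, tree `LubinTateColemanTraceKernelTwo`, seat cf2c-w7), and the measure of
`(1+S)^a · R((1+S)^p − 1)` is the image of `D_R` under `y ↦ a + p y` — supported on `a + pℤ_p ⊆ ℤ_p^×`.

* §1 `ProfiniteTower.affineCellMap a u` (the maps `b ↦ a + u b` on `ℤ/pⁿ`), `BoundedDistribution.affinePush`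
  (`= D.map (affineCellMap a u)`, tree `PAdicDistributionPushforward`), **`integral_affinePush`**:
  `∫ f d((a + u·)_* D) = ∫ f(a + u y) dD(y)`, and `affinePush_μ_succ_eq_zero`: `(a + p·)_* D` vanishes on
  the classes `≢ a (mod p)`;
* §2 `affineSeries a u H = (1+S)^a · (H ∘ [u])`, its coefficients and bound;
* §3 **`integral_mahlerFun₁_affine`**: `∫ ((a + u y) choose j) dD_H(y) = [S^j]((1+S)^a · H∘[u])` (Vandermonde
  + `integral_invAmice₁_mahlerFun₁_mul`), hence **`affinePush_invAmice₁_μ`**: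
  `(a + u·)_* D_H = D_{(1+S)^a · H∘[u]}` (all masses) and `integral_invAmice₁_affineSeries`;
* §4 **`invAmice₁_affineSeries_μ_eq_zero_of_not_isUnit`**: for `a ∈ ℤ_p^×`,
  `D_{(1+S)^a · H((1+S)^p − 1)}` vanishes on every non-unit class — the series form of "(7) ⟹ `μ_β` is
  supported on `ℤ_p^×`"; at `p = 2`, `a = 1`: `D_{(1+S)·R((1+S)²−1)} = (1 + 2·)_* D_R`.

Everything is a definition with a body or a theorem; no named facts, no instances, no `sorry`.

## References

* [deShalit1987] E. de Shalit, *Iwasawa theory of elliptic curves with complex multiplication* (1987),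
  I.3.1 (1) (p. 16), I.3.3 (7)–(7′) (p. 17), I.3.4 Lemma (ii) (p. 18).
* [MazurTateTeitelbaum1986Invent] B. Mazur, J. Tate, J. Teitelbaum, Invent. Math. 84 (1986), §I.11.
-/

noncomputable section

open Filter Topology Finset
open scoped fwdDiff Classical

namespace Literature.NumberTheory.EllipticCurves

variable {p : ℕ} [Fact p.Prime]

/-! ### §1. The affine cell maps `b ↦ a + u b` and the push-forward `(a + u·)_* D` -/

namespace ProfiniteTower

/-- The map `b ↦ a + u·b` on `ℤ/pⁿ` (`a, u ∈ ℤ_p` read modulo `pⁿ`). [cite: deShalit1987, I.3.4 Lemma (ii) (p. 18)] -/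
def affineMod (a u : ℤ_[p]) (n : ℕ) (b : ZMod (p ^ n)) : ZMod (p ^ n) :=
  PadicInt.toZModPow n a + PadicInt.toZModPow n u * b

/-- Unfolding `affineMod`. [cite: deShalit1987, I.3.4 Lemma (ii) (p. 18)] -/
theorem affineMod_apply (a u : ℤ_[p]) (n : ℕ) (b : ZMod (p ^ n)) :
    affineMod a u n b = PadicInt.toZModPow n a + PadicInt.toZModPow n u * b := rfl

/-- The maps `b ↦ a + u·b` commute with the reductions `ℤ/pⁿ⁺¹ → ℤ/pⁿ`.
[cite: deShalit1987, I.3.4 Lemma (ii) (p. 18)] -/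
theorem castHom_affineMod (a u : ℤ_[p]) (n : ℕ) (b : ZMod (p ^ (n + 1))) :
    ZMod.castHom (pow_dvd_pow p n.le_succ) (ZMod (p ^ n)) (affineMod a u (n + 1) b) =
      affineMod a u n (ZMod.castHom (pow_dvd_pow p n.le_succ) (ZMod (p ^ n)) b) := by
  simp only [affineMod, map_add, map_mul, ZMod.castHom_apply, PadicInt.cast_toZModPow n (n + 1) n.le_succ]

/-- **The affine cell maps `b ↦ a + u·b` on the levels `ℤ/pⁿ` of the `p`-adic tower**, lying under the
point map `y ↦ a + u y`. [cite: deShalit1987, I.3.4 Lemma (ii) (p. 18)] -/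
def affineCellMap (a u : ℤ_[p]) : (padicInt p).CellMap (padicInt p) where
  map n b := affineMod a u n b
  map_trans n b := (castHom_affineMod a u n b).symm

/-- The level-`n` map of `affineCellMap a u`. [cite: deShalit1987, I.3.4 Lemma (ii) (p. 18)] -/
theorem affineCellMap_map (a u : ℤ_[p]) (n : ℕ) (b : ZMod (p ^ n)) :
    (affineCellMap a u).map n b = PadicInt.toZModPow n a + PadicInt.toZModPow n u * b := rfl

/-- The point map `y ↦ a + u y` lies over `affineCellMap a u`. [cite: deShalit1987, I.3.4 Lemma (ii) (p. 18)] -/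
theorem proj_affine (a u : ℤ_[p]) (n : ℕ) (y : ℤ_[p]) :
    (padicInt p).proj n (a + u * y) = (affineCellMap a u).map n ((padicInt p).proj n y) := by
  rw [padicInt_proj, padicInt_proj, affineCellMap_map, map_add, map_mul]

/-- `y ↦ a + u y` is uniformly continuous on `ℤ_p`. [cite: deShalit1987, I.3.4 Lemma (ii) (p. 18)] -/
theorem uniformContinuous_affine (a u : ℤ_[p]) : UniformContinuous (fun y : ℤ_[p] ↦ a + u * y) :=
  CompactSpace.uniformContinuous_of_continuous (continuous_const.add (continuous_const.mul continuous_id))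

end ProfiniteTower

namespace BoundedDistribution

variable {𝕜 : Type*} [NormedField 𝕜] [IsUltrametricDist 𝕜]
variable (D : BoundedDistribution (ProfiniteTower.padicInt p) 𝕜)

/-- **The affine push-forward `(a + u·)_* D`** of a bounded distribution on `ℤ_p`.
[cite: deShalit1987, I.3.4 Lemma (ii) (p. 18)] -/
def affinePush (a u : ℤ_[p]) : BoundedDistribution (ProfiniteTower.padicInt p) 𝕜 :=
  D.map (ProfiniteTower.affineCellMap a u)

/-- The masses of `(a + u·)_* D`: `Σ_{a + u b = c} D(b)` over the classes `b mod pⁿ`.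
[cite: deShalit1987, I.3.4 Lemma (ii) (p. 18)] -/
theorem affinePush_μ (a u : ℤ_[p]) (n : ℕ) (c : ZMod (p ^ n)) :
    (D.affinePush a u).μ n c = ∑ b ∈ Finset.univ.filter
      (fun b : ZMod (p ^ n) ↦ PadicInt.toZModPow n a + PadicInt.toZModPow n u * b = c), D.μ n b := rfl

/-- **`∫ f d((a + u·)_* D) = ∫ f(a + u y) dD(y)`** for uniformly continuous `f` (change of variables).
[cite: MazurTateTeitelbaum1986Invent, §I.11] -/
theorem integral_affinePush [CompleteSpace 𝕜] (a u : ℤ_[p]) {f : ℤ_[p] → 𝕜} (hf : UniformContinuous f) :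
    (D.affinePush a u).integral f = D.integral (fun y ↦ f (a + u * y)) :=
  D.integral_map (ProfiniteTower.affineCellMap a u) (Φ := fun y ↦ a + u * y)
    (ProfiniteTower.proj_affine a u) hf (hf.comp (ProfiniteTower.uniformContinuous_affine a u))

/-- **`(a + p·)_* D` vanishes on the classes not congruent to `a` modulo `p`** (levels `n + 1`).
[cite: deShalit1987, I.3.3 (7′) (p. 17)] -/
theorem affinePush_μ_succ_eq_zero (a : ℤ_[p]) (n : ℕ) (c : ZMod (p ^ (n + 1)))
    (hc : ZMod.castHom (pow_dvd_pow p (Nat.succ_le_succ (Nat.zero_le n))) (ZMod (p ^ 1)) c ≠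
      PadicInt.toZModPow 1 a) :
    (D.affinePush a (p : ℤ_[p])).μ (n + 1) c = 0 := by
  rw [affinePush_μ]
  refine sum_eq_zero fun b hb ↦ ?_
  exfalso
  apply hc
  rw [← (mem_filter.mp hb).2, map_add, map_mul]
  simp only [ZMod.castHom_apply, PadicInt.cast_toZModPow 1 (n + 1) (Nat.succ_le_succ (Nat.zero_le n)),
    map_natCast, (ZMod.natCast_eq_zero_iff p (p ^ 1)).mpr (by rw [pow_one]), zero_mul, add_zero]

/-- **For `a ∈ ℤ_p^×`, `(a + p·)_* D` is supported on `ℤ_p^×`**: it vanishes on every non-unit class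
modulo `p^{n+1}`. [cite: deShalit1987, I.3.3 (7′) (p. 17)] -/
theorem affinePush_μ_succ_eq_zero_of_not_isUnit {a : ℤ_[p]} (ha : IsUnit a) (n : ℕ)
    (c : ZMod (p ^ (n + 1))) (hc : ¬ IsUnit c) : (D.affinePush a (p : ℤ_[p])).μ (n + 1) c = 0 := by
  have hp : p.Prime := Fact.out
  haveI : NeZero (p ^ (n + 1)) := ⟨pow_ne_zero _ hp.ne_zero⟩
  haveI : Fact (1 < p ^ 1) := ⟨by rw [pow_one]; exact hp.one_lt⟩
  refine D.affinePush_μ_succ_eq_zero a n c fun h ↦ ?_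
  have hdvd : p ∣ c.val := by
    rw [ZMod_isUnit_iff_not_dvd_val (Nat.succ_pos n) c, not_not] at hc
    exact hc
  have h0 : ZMod.castHom (pow_dvd_pow p (Nat.succ_le_succ (Nat.zero_le n))) (ZMod (p ^ 1)) c = 0 := by
    rw [ZMod.castHom_apply, ZMod.cast_eq_val, ZMod.natCast_eq_zero_iff, pow_one]
    exact hdvd
  have hunit : IsUnit (PadicInt.toZModPow 1 a) := (isUnit_toZModPow_one_iff a).mpr ha
  rw [h0] at h
  exact hunit.ne_zero h.symm

end BoundedDistribution

/-! ### §2. The series `(1+S)^a · H((1+S)^u − 1)` -/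

section Series

variable {𝕜 : Type*} [NormedField 𝕜] [NormedAlgebra ℚ_[p] 𝕜]

/-- **`(1+S)^a · (H ∘ [u])`** — the power series of `(a + u·)_* D_H` (`(1+S)^a = Σ_j (a choose j) S^j`,
`a ∈ ℤ_p`; `H ∘ [u] = binomDilate u H`). [cite: deShalit1987, I.3.1 (1) (p. 16), I.3.4 Lemma (ii) (p. 18)] -/
def affineSeries (a u : ℤ_[p]) (H : PowerSeries 𝕜) : PowerSeries 𝕜 :=
  (PowerSeries.binomialSeries ℤ_[p] a).map (padicIntCast 𝕜) * binomDilate u H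

/-- The coefficients of `(1+S)^a · (H ∘ [u])`: `Σ_{i+l=j} (a choose i) [S^l](H ∘ [u])`.
[cite: deShalit1987, I.3.1 (1) (p. 16)] -/
theorem coeff_affineSeries (a u : ℤ_[p]) (H : PowerSeries 𝕜) (j : ℕ) :
    PowerSeries.coeff j (affineSeries a u H) = ∑ il ∈ antidiagonal j,
      padicIntCast 𝕜 (Ring.choose a il.1) * PowerSeries.coeff il.2 (binomDilate u H) := by
  rw [affineSeries, PowerSeries.coeff_mul]
  refine sum_congr rfl fun il _ ↦ ?_
  rw [PowerSeries.coeff_map, coeff_binomialSeries_padicInt]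

variable [IsUltrametricDist 𝕜]

/-- **`(1+S)^a · (H ∘ [u])` has coefficients bounded by the bound of `H`.**
[cite: deShalit1987, I.3.1 (1) (p. 16)] -/
theorem norm_coeff_affineSeries_le {H : PowerSeries 𝕜} {C : ℝ} (hC : ∀ k, ‖PowerSeries.coeff k H‖ ≤ C)
    (a u : ℤ_[p]) (j : ℕ) : ‖PowerSeries.coeff j (affineSeries a u H)‖ ≤ C := by
  have hC0 : 0 ≤ C := (norm_nonneg _).trans (hC 0)
  rw [coeff_affineSeries]
  refine IsUltrametricDist.norm_sum_le_of_forall_le_of_nonneg hC0 fun il _ ↦ ?_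
  rw [norm_mul]
  calc ‖padicIntCast 𝕜 (Ring.choose a il.1)‖ * ‖PowerSeries.coeff il.2 (binomDilate u H)‖ ≤ 1 * C :=
        mul_le_mul (norm_padicIntCast_le_one _) (norm_coeff_binomDilate_le hC u il.2) (norm_nonneg _)
          zero_le_one
    _ = C := one_mul C

end Series

/-! ### §3. `(a + u·)_* D_H = D_{(1+S)^a · H∘[u]}` -/

section Dictionary

variable {𝕜 : Type*} [NormedField 𝕜] [NormedAlgebra ℚ_[p] 𝕜] [IsUltrametricDist 𝕜] [CompleteSpace 𝕜]
variable {H : PowerSeries 𝕜} {C : ℝ}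

omit [IsUltrametricDist 𝕜] [CompleteSpace 𝕜] in
/-- `y ↦ (u y choose l)` (read in `𝕜`) is uniformly continuous on `ℤ_p`. [cite: deShalit1987, I.3.4 (p. 18)] -/
theorem uniformContinuous_mahlerFun₁_mul (l : ℕ) (u : ℤ_[p]) :
    UniformContinuous (fun y : ℤ_[p] ↦ mahlerFun₁ 𝕜 l (u * y)) :=
  (uniformContinuous_mahlerFun₁ l).comp
    (CompactSpace.uniformContinuous_of_continuous (continuous_const.mul continuous_id))

/-- **Vandermonde under the integral: `∫ ((a + u y) choose j) dD_H(y) = [S^j]((1+S)^a · H∘[u])`**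
(`(a + u y choose j) = Σ_{i+l=j} (a choose i)(u y choose l)` and `∫ (u y choose l) dD_H = [S^l](H∘[u])`).
[cite: deShalit1987, I.3.1 (1) (p. 16), I.3.4 Lemma (ii) (p. 18)] -/
theorem integral_mahlerFun₁_affine (hC : ∀ k, ‖PowerSeries.coeff k H‖ ≤ C) (a u : ℤ_[p]) (j : ℕ) :
    (invAmice₁ p H hC).integral (fun y ↦ mahlerFun₁ 𝕜 j (a + u * y)) =
      PowerSeries.coeff j (affineSeries a u H) := by
  have hfun : (fun y : ℤ_[p] ↦ mahlerFun₁ 𝕜 j (a + u * y)) = fun y ↦ ∑ il ∈ antidiagonal j,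
      padicIntCast 𝕜 (Ring.choose a il.1) * mahlerFun₁ 𝕜 il.2 (u * y) := by
    funext y
    rw [mahlerFun₁_apply]
    change padicIntCast 𝕜 (Ring.choose (a + u * y) j) = _
    rw [Ring.add_choose_eq j (Commute.all _ _), map_sum]
    refine sum_congr rfl fun il _ ↦ ?_
    rw [map_mul, mahlerFun₁_apply]
    rfl
  rw [hfun, (invAmice₁ p H hC).integral_finset_sum _ (fun il _ ↦
      (uniformContinuous_mahlerFun₁_mul il.2 u).const_mul' _), coeff_affineSeries]
  refine sum_congr rfl fun il _ ↦ ?_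
  rw [(invAmice₁ p H hC).integral_const_mul _ (uniformContinuous_mahlerFun₁_mul il.2 u),
    integral_invAmice₁_mahlerFun₁_mul hC u il.2]

/-- **`(a + u·)_* D_H = D_{(1+S)^a · H∘[u]}`** (all masses): the distribution of `(1+S)^a · H((1+S)^u − 1)`
is the image of `D_H` under `y ↦ a + u y` — translation is multiplication by `(1+S)^a`, dilation is the
substitution `[u]` (both sides have the Mahler moments `[S^j]((1+S)^a · H∘[u])`).
[cite: deShalit1987, I.3.1 (1) (p. 16), I.3.4 Lemma (ii) (p. 18)] -/
theorem affinePush_invAmice₁_μ (hC : ∀ k, ‖PowerSeries.coeff k H‖ ≤ C) (a u : ℤ_[p]) (n : ℕ)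
    (c : ZMod (p ^ n)) :
    ((invAmice₁ p H hC).affinePush a u).μ n c =
      (invAmice₁ p (affineSeries a u H) (norm_coeff_affineSeries_le hC a u)).μ n c := by
  refine BoundedDistribution.μ_eq_of_integral_mahlerFun₁_eq _ _ (fun j ↦ ?_) n c
  rw [(invAmice₁ p H hC).integral_affinePush a u (uniformContinuous_mahlerFun₁ j),
    integral_mahlerFun₁_affine hC a u j, integral_invAmice₁_mahlerFun₁]

/-- **`∫ g dD_{(1+S)^a · H∘[u]} = ∫ g(a + u y) dD_H(y)`** for uniformly continuous `g`.
[cite: deShalit1987, I.3.1 (1) (p. 16), I.3.4 Lemma (ii) (p. 18)] -/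
theorem integral_invAmice₁_affineSeries (hC : ∀ k, ‖PowerSeries.coeff k H‖ ≤ C) (a u : ℤ_[p])
    {g : ℤ_[p] → 𝕜} (hg : UniformContinuous g) :
    (invAmice₁ p (affineSeries a u H) (norm_coeff_affineSeries_le hC a u)).integral g =
      (invAmice₁ p H hC).integral (fun y ↦ g (a + u * y)) := by
  rw [← (invAmice₁ p H hC).integral_affinePush a u hg]
  exact BoundedDistribution.integral_eq_of_μ_eq (fun n c ↦ (affinePush_invAmice₁_μ hC a u n c).symm) g

/-! ### §4. The series form of (7) ⟹ (7′): `D_{(1+S)^a · H((1+S)^p − 1)}` is supported on `ℤ_p^×` -/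

/-- **De Shalit's (7) ⟹ "`μ` is supported on `ℤ_p^×`", series form**: for `a ∈ ℤ_p^×` the distribution
of `(1+S)^a · H((1+S)^p − 1)` (an element of the kernel of the `Ĝ_m`-trace) vanishes on every non-unit
class modulo `p^{n+1}` — it is `(a + p·)_* D_H`, carried by `a + pℤ_p ⊆ ℤ_p^×`. At `p = 2`, `a = 1`:
`D_{(1+S)·R((1+S)²−1)} = (1 + 2·)_* D_R`. [cite: deShalit1987, I.3.3 (7)–(7′) (p. 17)] -/
theorem invAmice₁_affineSeries_μ_eq_zero_of_not_isUnit (hC : ∀ k, ‖PowerSeries.coeff k H‖ ≤ C)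
    {a : ℤ_[p]} (ha : IsUnit a) (n : ℕ) (c : ZMod (p ^ (n + 1))) (hc : ¬ IsUnit c) :
    (invAmice₁ p (affineSeries a (p : ℤ_[p]) H) (norm_coeff_affineSeries_le hC a p)).μ (n + 1) c = 0 := by
  rw [← affinePush_invAmice₁_μ hC a (p : ℤ_[p]) (n + 1) c]
  exact (invAmice₁ p H hC).affinePush_μ_succ_eq_zero_of_not_isUnit ha n c hc

/-- Hence `∫ f d(D_{(1+S)^a·H∘[p]}|_{ℤ_p^×}) = ∫ f dD_{(1+S)^a·H∘[p]} = ∫ f(a + p y) dD_H(y)` for uniformly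
continuous `f` (`a ∈ ℤ_p^×`). [cite: deShalit1987, I.3.3 (7)–(8) (p. 17–18)] -/
theorem integral_restrictUnits_invAmice₁_affineSeries (hC : ∀ k, ‖PowerSeries.coeff k H‖ ≤ C)
    {a : ℤ_[p]} (ha : IsUnit a) {f : ℤ_[p] → 𝕜} (hf : UniformContinuous f) :
    (restrictUnits (invAmice₁ p (affineSeries a (p : ℤ_[p]) H) (norm_coeff_affineSeries_le hC a p))).integral f =
      (invAmice₁ p H hC).integral (fun y ↦ f (a + p * y)) := by
  rw [(invAmice₁ p (affineSeries a (p : ℤ_[p]) H) (norm_coeff_affineSeries_le hC a p)).integral_restrictUnits_eq_of_forall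
      (fun n c hc ↦ invAmice₁_affineSeries_μ_eq_zero_of_not_isUnit hC ha n c hc) hf,
    integral_invAmice₁_affineSeries hC a p hf]

end Dictionary

end Literature.NumberTheory.EllipticCurves

end
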